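import Summits.CriticalPhenomena.Ising3DConformalLimit.Theses.UnitLightCone
import HarnessLib

/-!
# Strategist census sketch — crux `ClusterSetTotallyDisconnected` (stmt-CriticalPhenomena-4659), seat b1

Typed artefacts quoted in `STRATEGY-CENSUS.md` (all `def … : Prop`, the glue theorems proved, no `sorry`):
STRENGTHEN candidates S⁺₁–S⁺₄, the alternative DECOMPOSITIONS D4/D5 with their (trivial) glue, and the NEGATION
object N1 (a non-Gaussian discretely-but-not-continuously scale covariant Euclidean family), each with the one-line
reason it gives no leverage recorded in the census.  The line that DOES have teeth is `Lines/cluster_light_cone.lean`.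
-/

namespace Summit.CriticalPhenomena.Ising3DConformalLimit.Cruxes.ClusterSetTotallyDisconnected.StrategistB1

open scoped Topology
open Filter Set Literature.Probability.LatticeModels

/-- `ρ★` (verbatim the crux's). -/
noncomputable def rhoStar : ℝ → ℝ := fun δ : ℝ => (criticalTwoPoint 3 (Pi.single 0 ⌊δ⁻¹⌋)) ^ (-(1/2:ℝ))

/-- The cluster set `𝒞` (verbatim the crux's set-builder with `ρ★` named). -/
def clusterSet : Set (CorrFamily 3) :=
  {S | (∀ n x, x ∉ NonCoincident 3 n → S n x = 0) ∧ ∃ u : ℕ → ℝ, (∀ k, u k ∈ Set.Ioc (0:ℝ) 1) ∧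
    Filter.Tendsto u Filter.atTop (nhds 0) ∧ ∀ n, TendstoLocallyUniformlyOn
      (fun k => rescaledCorrelator (criticalCorr 3) rhoStar n (u k)) (S n) Filter.atTop (NonCoincident 3 n)}

/-- The crux (UnitLightCone copy) through the vocabulary. -/
theorem crux_iff :
    Summit.CriticalPhenomena.Ising3DConformalLimit.Theses.UnitLightCone.ClusterSetTotallyDisconnected ↔
      IsTotallyDisconnected clusterSet := Iff.rfl

/-! ## STRENGTHEN -/

/-- S⁺₁ — the two-point function DETERMINES the cluster point (`π₂` injective on `𝒞`).  Stronger than birth's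
`stub_fibrewiseTD` (fibres become subsingletons) and, with `stub_twoPointImageTD`, than the crux. -/
def TwoPointDeterminesClusterPoint : Prop :=
  Set.InjOn (fun S : CorrFamily 3 => S 2) clusterSet

/-- S⁺₂ — the cluster set is COUNTABLE.  In the (completely regular) product topology a countable set is
totally disconnected, so S⁺₂ ⟹ crux; under compactness (item 5955) a countable continuum is a point. -/
def ClusterSetCountable : Prop := clusterSet.Countable

/-- S⁺₃ — INDUCTIVE DETERMINATION: on `𝒞`, the correlators of orders `≤ 2m` determine order `2m + 2`
(odd orders vanish at `β_c`).  With `stub_twoPointImageTD` it gives the crux by induction. -/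
def InductiveDetermination : Prop :=
  ∀ S ∈ clusterSet, ∀ S' ∈ clusterSet, ∀ m : ℕ, (∀ k ≤ m, S (2 * k) = S' (2 * k)) → S (2 * m + 2) = S' (2 * m + 2)

/-- S⁺₄ — every cluster point is a FIXED POINT of the re-pinned dilation flow, i.e. exactly scale covariant.
NOT a strengthening in truth value: it is a landed CONSEQUENCE of the crux
(`isScaleCovariant_of_clusterSetTotallyDisconnected`, Theorems/…FoldedCurrentClusterSetScaleCovariant.lean) and does
not imply it (an arc of pure-power Wick families is fixed pointwise and connected). -/
def ClusterPointsFixed : Prop :=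
  ∀ S ∈ clusterSet, ∃ Δ : ℝ, IsScaleCovariant Δ S

/-! ## DECOMPOSITION (alternatives to birth's {image, fibre} and to the registered line) -/

/-- D4, piece 2 — the scale-covariant members of `𝒞` form a totally disconnected set ("the fixed-point set of the
zoom inside `𝒞` is totally disconnected": no conformal manifold / no drifting exponent among FIXED points). -/
def FixedSetTD : Prop :=
  IsTotallyDisconnected {S : CorrFamily 3 | S ∈ clusterSet ∧ ∃ Δ : ℝ, IsScaleCovariant Δ S}

/-- D4 glue (proved): `ClusterPointsFixed → FixedSetTD → crux` — under piece 1 the fixed-point set IS `𝒞`. -/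
theorem crux_of_fixed (h1 : ClusterPointsFixed) (h2 : FixedSetTD) :
    Summit.CriticalPhenomena.Ising3DConformalLimit.Theses.UnitLightCone.ClusterSetTotallyDisconnected := by
  rw [crux_iff]
  intro t ht hpre
  exact h2 t (fun S hS => ⟨ht hS, h1 S (ht hS)⟩) hpre

/-- D5 glue (proved): S⁺₁ discharges birth's fibre stub — fibres of an injective map are subsingletons. -/
theorem fibrewiseTD_of_injOn (h : TwoPointDeterminesClusterPoint) :
    ∀ G : (Fin 2 → EuclideanSpace ℝ (Fin 3)) → ℝ,
      IsTotallyDisconnected {S : CorrFamily 3 | S ∈ clusterSet ∧ (fun S : CorrFamily 3 => S 2) S = G} := by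
  intro G t ht _ S hS T hT
  exact h (ht hS).1 (ht hT).1 ((ht hS).2.trans (ht hT).2.symm)

/-- S⁺₂ ⟹ crux (proved): a countable subset of `CorrFamily 3` is totally disconnected — separate two points by a
continuous real functional (an evaluation) and cut at a non-attained level. -/
theorem crux_of_countable (h : ClusterSetCountable) :
    Summit.CriticalPhenomena.Ising3DConformalLimit.Theses.UnitLightCone.ClusterSetTotallyDisconnected := by
  rw [crux_iff]
  intro t ht hpre
  -- a preconnected countable subset of a space whose points are separated by continuous real functions is a
  -- subsingleton
  intro S hS T hT
  by_contra hne
  -- an evaluation functional separating `S` and `T`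
  obtain ⟨n, x, hx⟩ : ∃ n x, S n x ≠ T n x := by
    by_contra hall
    push Not at hall
    exact hne (funext fun n => funext fun x => hall n x)
  let ev : CorrFamily 3 → ℝ := fun R => R n x
  have hev : Continuous ev := (continuous_apply x).comp (continuous_apply n)
  -- the image of `t` under `ev` is a preconnected countable subset of ℝ containing two points: impossible
  have himg : IsPreconnected (ev '' t) := hpre.image ev hev.continuousOn
  have hcount : (ev '' t).Countable := (h.mono ht).image ev
  have hS' : ev S ∈ ev '' t := mem_image_of_mem ev hS
  have hT' : ev T ∈ ev '' t := mem_image_of_mem ev hT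
  -- preconnected subsets of ℝ are order-connected, hence contain the interval between `ev S` and `ev T`
  have hord : OrdConnected (ev '' t) := himg.ordConnected
  -- a non-degenerate real interval is uncountable
  have hunc : ∀ {a b : ℝ}, a < b → Icc a b ⊆ ev '' t → False := by
    intro a b hab hsub
    have h1 := (hcount.mono hsub).mono (Ioo_subset_Icc_self (a := a) (b := b))
    rw [← Cardinal.le_aleph0_iff_set_countable, Cardinal.mk_Ioo_real hab] at h1
    exact h1.not_gt Cardinal.aleph0_lt_continuum
  rcases lt_or_gt_of_ne hx with hlt | hlt
  · exact hunc hlt (hord.out hS' hT')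
  · exact hunc hlt (hord.out hT' hS')

/-! ## NEGATION — the object a counterexample would be, and what obstructs building it from the lattice -/

/-- N1 — a NON-GAUSSIAN, Euclidean-invariant family that is discretely (`λ₀`) but NOT continuously scale
covariant.  Such families EXIST as continuum objects (census §Negation: `:φ²:` of a generalised free field with a
log-periodically modulated Källén–Lehmann weight — OS-positive, unit light cone in every frame, `U₄ ≢ 0`), so none of
{RP, Euclidean invariance, light cone, non-Gaussianity} can by itself exclude a limit cycle of the zoom; what is NOT
known is whether one arises as the cluster set of a finite-range reflection-positive lattice model. -/
def NonGaussianDSIFamilyExists : Prop :=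
  ∃ (S : CorrFamily 3) (Δ lam : ℝ), 1 < lam ∧ 0 < Δ ∧ IsEuclideanInvariant S ∧ HasNontrivialU4 S ∧
    IsNondegenerateTwoPoint S ∧
    (∀ n (x : Fin n → EuclideanSpace ℝ (Fin 3)), S n (fun i => lam • x i) = lam ^ (-(n : ℝ) * Δ) * S n x) ∧
    ¬ IsScaleCovariant Δ S

end Summit.CriticalPhenomena.Ising3DConformalLimit.Cruxes.ClusterSetTotallyDisconnected.StrategistB1
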